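import Summits.CriticalPhenomena.PercolationContinuityZ3.Theorems.PercNearOneGluingNoHeavyLowerTailQuantitativeS5PocketZeroSet
import HarnessLib

/-!
# Bricks of the gates-first mechanism: exits of a pocket, nonnegativity of the floor's summands, positivity of the isolated term and of the detachment constant

Support file (`--supports stmt-CriticalPhenomena-4575`), prover seat `prim-rate-mine-2` (lane prim-rate, constants-miner (c), BENCH row
M2-R41; `run/shared/lean/prim/prim-rate/prim-rate-mine-2/PROOFS.md` §P41).  No definitions, no named facts, no sorries; standard axioms.

Weights non-degenerate on their support `E`; the explicit (S5) floor with a general decoy list `D`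
(`Σ_a γ_a(r)·q_a + ∏_{e ∩ T_{<a} ≠ ∅}(1 − w_e)·Cov_{w_{T_{<a}}}(F(V 𝒞_a), 1{o ↔ {a} ∪ T_{>a} ∪ D ∨ o ↔ v})`; for `D = []` verbatim the floor of
`CSH.s5dMargin_ge_sum_rankGain_add_isolatedFloor_of_lt_one_of_compat`).

* `CSH.exists_exit_of_walk_set` — an open walk out of a pocket `K` (exits at `v` or in `X`) passes an exit pair;
* `CSH.floor_summand_nonneg` — every summand is `≥ 0` (compatible rank, `F` monotone `≥ 0`; `CSH.rankGain_nonneg`, `CSH.harrisTerm_clusterFun_nonneg`);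
* `CSH.floor_iso_pos_of_pivotal` — the isolated term of `a` is `> 0` when some pair of `E − pairs(T_{<a})` is influential for `F(V 𝒞_a)` and
  pivotal for the floor's event (Harris' equality case for functions, `QuantHarris.cov_pos_iff_exists_influence`, under the zeroed weights);
* `CSH.avoidConst_pos_of_pocket_adj` — `q_k > 0` when `k` is `E`-adjacent to a pocket internally connected from `o` and the avoided set misses
  the pocket (one configuration of positive mass, `QuantHarris.real_pos_of_mem`).
[cite: Harris1960, Lemma 4.1 (p. 16)] [cite: KozmaNitzan2024, Conj. 4 (p. 32)] [cite: Grimmett1999, §2.2]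
-/

noncomputable section

namespace Summit.CriticalPhenomena.PercolationContinuityZ3.Theorems

open MeasureTheory Set Literature.Probability.LatticeModels Literature.Probability.Percolation
open scoped Classical
open KNPreFKG

namespace CSH

variable {n : ℕ}

/-- A walk of `ω ⊆ E` from inside a pocket `K` (whose `E`-exits end at `v` or in `X`) to a vertex outside `K` passes an exit: some pair
`s(p, q) ∈ ω` with `p ∈ K`, `q = v ∨ q ∈ X`, and `q` reached from the start. [folklore] -/
theorem exists_exit_of_walk_set {V : Type*} {E ω : Set (Sym2 V)} (hωE : ω ⊆ E) {K X : Set V} {v : V}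
    (hK : ∀ p q : V, s(p, q) ∈ E → p ∈ K → q ∈ K ∨ q = v ∨ q ∈ X) :
    ∀ {u t : V} (W : (openGraph ω).Walk u t), u ∈ K → t ∉ K →
      ∃ p q : V, p ∈ K ∧ (q = v ∨ q ∈ X) ∧ s(p, q) ∈ ω ∧ (openGraph ω).Reachable u q := by
  intro u t W
  induction W with
  | nil => intro hu ht; exact absurd hu ht
  | @cons u u₁ t hadj W' ih =>
    intro hu ht
    have he : s(u, u₁) ∈ ω ∧ u ≠ u₁ := by rw [openGraph, SimpleGraph.fromEdgeSet_adj] at hadj; exact hadj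
    by_cases hu₁ : u₁ ∈ K
    · obtain ⟨p, q, hp, hq, hpq, hreach⟩ := ih hu₁ ht
      exact ⟨p, q, hp, hq, hpq, hadj.reachable.trans hreach⟩
    · rcases hK u u₁ (hωE he.1) hu with h | h | h
      · exact absurd h hu₁
      · exact ⟨u, u₁, hu, Or.inl h, he.1, hadj.reachable⟩
      · exact ⟨u, u₁, hu, Or.inr h, he.1, hadj.reachable⟩

/-- Every summand of the explicit floor (general decoy list) is nonnegative for a compatible rank and a monotone nonnegative `F`.
[cite: Harris1960, Lemma 4.1 (p. 16)] -/
theorem floor_summand_nonneg (w : Sym2 (Fin n) → unitInterval) (o v : Fin n) (T : Finset (Fin n)) (r : Fin n → ℕ) (D : List (Fin n))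
    (F : Set (Fin n) → ℝ) (hF : ∀ S S' : Set (Fin n), S ⊆ S' → F S ≤ F S') (hF0 : ∀ S : Set (Fin n), 0 ≤ F S)
    (hcompat : ∀ a ∈ T, ∀ a' ∈ T, r a < r a' →
      ∫ ω, F (openCluster ω a) ∂(prodBernoulli w) ≤ ∫ ω, F (openCluster ω a') ∂(prodBernoulli w))
    (a : Fin n) (ha : a ∈ T) :
    0 ≤ rankGain w T r F a * avoidConst w a ((↑(T.erase a) : Set (Fin n)) ∪ ({d | d ∈ D} ∪ {v})) o ∧
    0 ≤ (∏ e ∈ Finset.univ.filter (fun e : Sym2 (Fin n) => ∃ y ∈ (↑(T.filter (fun b => r b < r a)) : Set (Fin n)), y ∈ e), (1 - (w e : ℝ))) *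
          ((∫ η in ((⋃ t ∈ (insert a (T.filter (fun b => r a < r b) ∪ (D).toFinset)), openConn o t) ∪ openConn o v),
              F {c | c = a ∨ ∃ e ∈ openEdgeCluster η a, c ∈ e}
              ∂(prodBernoulli fun e => if (∃ y ∈ (↑(T.filter (fun b => r b < r a)) : Set (Fin n)), y ∈ e) then (0 : unitInterval) else w e)) -
            (prodBernoulli fun e => if (∃ y ∈ (↑(T.filter (fun b => r b < r a)) : Set (Fin n)), y ∈ e) then (0 : unitInterval) else w e).real
                ((⋃ t ∈ (insert a (T.filter (fun b => r a < r b) ∪ (D).toFinset)), openConn o t) ∪ openConn o v) *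
              (∫ η, F {c | c = a ∨ ∃ e ∈ openEdgeCluster η a, c ∈ e}
                ∂(prodBernoulli fun e => if (∃ y ∈ (↑(T.filter (fun b => r b < r a)) : Set (Fin n)), y ∈ e) then (0 : unitInterval) else w e))) := by
  refine ⟨mul_nonneg (rankGain_nonneg w T r F a fun a' ha' hlt => hcompat a' ha' a ha hlt) ?_, mul_nonneg ?_ ?_⟩
  · unfold avoidConst
    exact div_nonneg measureReal_nonneg measureReal_nonneg
  · exact Finset.prod_nonneg fun e _ => sub_nonneg.2 (w e).2.2
  · refine harrisTerm_clusterFun_nonneg _ a _ ?_ F hF hF0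
    rintro ω ω' hle (h | h)
    · obtain ⟨t, ht, h⟩ := Set.mem_iUnion₂.1 h
      exact Or.inl (Set.mem_iUnion₂.2 ⟨t, ht, SimpleGraph.Reachable.mono (BHK2006.openGraph_le hle) h⟩)
    · exact Or.inr (SimpleGraph.Reachable.mono (BHK2006.openGraph_le hle) h)

/-- **The isolated Harris term of a relay is positive under the pivotal criterion, general `F` and decoy list.**  Weights non-degenerate on
their support `E`; `F` monotone nonnegative; a pair `e ∈ E` missing `T_{<a}` which, at configurations inside `E − pairs(T_{<a})`, is influential for
`F(V 𝒞_a)` and pivotal for the floor's event `{o ↔ {a} ∪ T_{>a} ∪ D} ∪ {o ↔ v}`.  Then the `a`-term `∏(1 − w)·Cov` of the floor is positive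
(`QuantHarris.cov_pos_iff_exists_influence` for the zeroed weights). [cite: Harris1960, Lemma 4.1 (p. 16)] -/
theorem floor_iso_pos_of_pivotal (w : Sym2 (Fin n) → unitInterval) (E : Set (Sym2 (Fin n)))
    (hE0 : ∀ f, f ∉ E → (w f : ℝ) = 0) (hE1 : ∀ f ∈ E, 0 < (w f : ℝ) ∧ (w f : ℝ) < 1) (o v : Fin n)
    (T : Finset (Fin n)) (r : Fin n → ℕ) (D : List (Fin n)) (a : Fin n)
    (F : Set (Fin n) → ℝ) (hF : ∀ S S' : Set (Fin n), S ⊆ S' → F S ≤ F S') (hF0 : ∀ S : Set (Fin n), 0 ≤ F S)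
    (e : Sym2 (Fin n)) (heE : e ∈ E) (heY : ∀ y ∈ (↑(T.filter (fun b => r b < r a)) : Set (Fin n)), y ∉ e)
    (hFpiv : ∃ η : Set (Sym2 (Fin n)), η ⊆ {f | f ∈ E ∧ ∀ y ∈ (↑(T.filter (fun b => r b < r a)) : Set (Fin n)), y ∉ f} ∧
      F {c | c = a ∨ ∃ e' ∈ openEdgeCluster (η \ {e}) a, c ∈ e'} < F {c | c = a ∨ ∃ e' ∈ openEdgeCluster (insert e η) a, c ∈ e'})
    (hUpiv : ∃ η : Set (Sym2 (Fin n)), η ⊆ {f | f ∈ E ∧ ∀ y ∈ (↑(T.filter (fun b => r b < r a)) : Set (Fin n)), y ∉ f} ∧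
      insert e η ∈ ((⋃ t ∈ (insert a (T.filter (fun b => r a < r b) ∪ D.toFinset)), openConn o t) ∪ openConn o v :
        Set (BondConfig (Fin n))) ∧
      η \ {e} ∉ ((⋃ t ∈ (insert a (T.filter (fun b => r a < r b) ∪ D.toFinset)), openConn o t) ∪ openConn o v :
        Set (BondConfig (Fin n)))) :
    0 < (∏ e ∈ Finset.univ.filter (fun e : Sym2 (Fin n) => ∃ y ∈ (↑(T.filter (fun b => r b < r a)) : Set (Fin n)), y ∈ e), (1 - (w e : ℝ))) *
          ((∫ η in ((⋃ t ∈ (insert a (T.filter (fun b => r a < r b) ∪ (D).toFinset)), openConn o t) ∪ openConn o v),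
              F {c | c = a ∨ ∃ e ∈ openEdgeCluster η a, c ∈ e}
              ∂(prodBernoulli fun e => if (∃ y ∈ (↑(T.filter (fun b => r b < r a)) : Set (Fin n)), y ∈ e) then (0 : unitInterval) else w e)) -
            (prodBernoulli fun e => if (∃ y ∈ (↑(T.filter (fun b => r b < r a)) : Set (Fin n)), y ∈ e) then (0 : unitInterval) else w e).real
                ((⋃ t ∈ (insert a (T.filter (fun b => r a < r b) ∪ (D).toFinset)), openConn o t) ∪ openConn o v) *
              (∫ η, F {c | c = a ∨ ∃ e ∈ openEdgeCluster η a, c ∈ e}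
                ∂(prodBernoulli fun e => if (∃ y ∈ (↑(T.filter (fun b => r b < r a)) : Set (Fin n)), y ∈ e) then (0 : unitInterval) else w e))) := by
  have hmeas : ∀ S : Set (BondConfig (Fin n)), MeasurableSet S := fun _ => MeasurableSet.of_discrete
  have hw1r : ∀ e, (w e : ℝ) < 1 := by
    intro e
    by_cases he : e ∈ E
    · exact (hE1 e he).2
    · rw [hE0 e he]; norm_num
  obtain ⟨η, hηEY, hFlt⟩ := hFpiv
  obtain ⟨η', hη'EY, hU1, hU0⟩ := hUpiv
  set Y : Set (Fin n) := (↑(T.filter (fun b => r b < r a)) : Set (Fin n)) with hY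
  set U : Set (BondConfig (Fin n)) :=
    (⋃ t ∈ (insert a (T.filter (fun b => r a < r b) ∪ D.toFinset)), openConn o t) ∪ openConn o v with hU
  set qY : Sym2 (Fin n) → unitInterval := fun e => if (∃ y ∈ Y, y ∈ e) then (0 : unitInterval) else w e with hqY
  set EY : Set (Sym2 (Fin n)) := {f | f ∈ E ∧ ∀ y ∈ Y, y ∉ f} with hEY
  set f : BondConfig (Fin n) → ℝ := fun ζ => F {c | c = a ∨ ∃ e ∈ openEdgeCluster ζ a, c ∈ e} with hfdef
  have hUup : ∀ ω ω' : BondConfig (Fin n), ω ⊆ ω' → ω ∈ U → ω' ∈ U := by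
    rintro ω ω' hle (h | h)
    · obtain ⟨t, ht, h⟩ := Set.mem_iUnion₂.1 h
      exact Or.inl (Set.mem_iUnion₂.2 ⟨t, ht, SimpleGraph.Reachable.mono (BHK2006.openGraph_le hle) h⟩)
    · exact Or.inr (SimpleGraph.Reachable.mono (BHK2006.openGraph_le hle) h)
  have hfmono : Monotone f := fun _ _ h => (monotone_clusterFun a F hF) (BHK2006.openEdgeCluster_mono h a)
  have hf0 : ∀ ζ, 0 ≤ f ζ := fun _ => hF0 _
  have hq0 : ∀ e, e ∉ EY → ((qY e : unitInterval) : ℝ) = 0 := by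
    intro e he
    simp only [hqY]
    by_cases hc : ∃ y ∈ Y, y ∈ e
    · rw [if_pos hc]; rfl
    · rw [if_neg hc]
      apply hE0 e
      intro heE
      exact he ⟨heE, fun y hy hye => hc ⟨y, hy, hye⟩⟩
  have hq1 : ∀ e ∈ EY, 0 < ((qY e : unitInterval) : ℝ) ∧ ((qY e : unitInterval) : ℝ) < 1 := by
    intro e he
    have hc : ¬ ∃ y ∈ Y, y ∈ e := by
      rintro ⟨y, hy, hye⟩
      exact he.2 y hy hye
    simp only [hqY]
    rw [if_neg hc]
    exact hE1 e he.1
  have hcov := (QuantHarris.cov_pos_iff_exists_influence qY EY hq0 hq1 f (U.indicator fun _ => (1 : ℝ)) hf0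
    (fun ω => Set.indicator_nonneg (fun _ _ => zero_le_one) ω) hfmono (QuantHarris.indicator_upset_monotone hUup)).2
    ⟨e, ⟨heE, heY⟩, ⟨η, hηEY, by simp only [hfdef]; exact hFlt.ne'⟩,
      ⟨η', hη'EY, by rw [Set.indicator_of_mem hU1, Set.indicator_of_notMem hU0]; exact one_ne_zero⟩⟩
  have hprod : (fun ζ => f ζ * U.indicator (fun _ => (1 : ℝ)) ζ) = U.indicator f := by
    funext ζ
    by_cases hζ : ζ ∈ U
    · rw [Set.indicator_of_mem hζ, Set.indicator_of_mem hζ, mul_one]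
    · rw [Set.indicator_of_notMem hζ, Set.indicator_of_notMem hζ, mul_zero]
  rw [hprod, integral_indicator (hmeas U), integral_indicator (hmeas U)] at hcov
  simp only [integral_const, smul_eq_mul, mul_one, measureReal_restrict_apply_univ] at hcov
  have hiso : 0 < (∫ ζ in U, f ζ ∂(prodBernoulli qY)) - (prodBernoulli qY).real U * ∫ ζ, f ζ ∂(prodBernoulli qY) := by
    linarith [hcov, mul_comm ((prodBernoulli qY).real U) (∫ ζ, f ζ ∂(prodBernoulli qY))]
  have hprodpos : 0 < ∏ e ∈ Finset.univ.filter (fun e : Sym2 (Fin n) => ∃ y ∈ Y, y ∈ e), (1 - (w e : ℝ)) :=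
    Finset.prod_pos fun e _ => by linarith [hw1r e]
  have h := mul_pos hprodpos hiso
  simp only [hY, hU, hqY, hfdef] at h
  exact h

/-- **A detachment constant is positive when the relay touches the pocket.**  Weights non-degenerate on their support `E`; `K` internally
connected from `o`; `y ∈ K` with `s(y, k) ∈ E`, `k ∉ K`; the avoided set `A` misses `K ∪ {k}`.  Then `0 < avoidConst w k A o`.
[cite: Harris1960, Lemma 4.1 (p. 16)] -/
theorem avoidConst_pos_of_pocket_adj (w : Sym2 (Fin n) → unitInterval) (E : Set (Sym2 (Fin n)))
    (hE0 : ∀ f, f ∉ E → (w f : ℝ) = 0) (hE1 : ∀ f ∈ E, 0 < (w f : ℝ) ∧ (w f : ℝ) < 1)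
    (K : Set (Fin n)) (o : Fin n) (hKconn : ∀ y ∈ K, (openGraph {f | f ∈ E ∧ ∀ z ∈ f, z ∈ K}).Reachable o y)
    (k y : Fin n) (hy : y ∈ K) (hyk : s(y, k) ∈ E) (hkK : k ∉ K) (A : Set (Fin n)) (hAK : ∀ a ∈ A, a ∉ K) (hkA : k ∉ A) :
    0 < avoidConst w k A o := by
  obtain ⟨W⟩ := hKconn y hy
  set η : Set (Sym2 (Fin n)) := insert s(y, k) {g | g ∈ W.edges} with hηdef
  have hWE : ∀ g ∈ W.edges, g ∈ E ∧ ∀ z ∈ g, z ∈ K := fun g hg => (QuantBHK.mem_and_not_isDiag_of_mem_edges W hg).1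
  have hηE : η ⊆ E := by
    rintro g (rfl | hg)
    · exact hyk
    · exact (hWE g hg).1
  have hηK : ∀ g ∈ η, ∀ z ∈ g, z ∈ K ∨ z = k := by
    rintro g (rfl | hg) z hz
    · rcases Sym2.mem_iff.1 hz with rfl | rfl
      · exact Or.inl hy
      · exact Or.inr rfl
    · exact Or.inl ((hWE g hg).2 z hz)
  have hreachK : ∀ z, (openGraph η).Reachable k z → z ∈ K ∨ z = k := fun z hz =>
    forall_reachable_of_edges (S := η) (fun z => z ∈ K ∨ z = k) (Or.inr rfl) hηK hz
  have hmem : η ∈ ({ω : BondConfig (Fin n) | ∀ a ∈ A, ¬ (openGraph ω).Reachable k a} ∩ openConn k o : Set (BondConfig (Fin n))) := by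
    refine ⟨fun a ha hka => ?_, ?_⟩
    · rcases hreachK a hka with h | h
      · exact hAK a ha h
      · exact hkA (h ▸ ha)
    · have hoy : (openGraph η).Reachable o y :=
        (QuantBHK.reachable_of_walk_edges_subset W fun g hg => hg).mono (BHK2006.openGraph_le (Set.subset_insert _ _))
      have hky : (openGraph η).Adj k y := by
        rw [openGraph, SimpleGraph.fromEdgeSet_adj]
        exact ⟨by rw [Sym2.eq_swap]; exact Set.mem_insert _ _, fun h => hkK (h ▸ hy)⟩
      exact hky.reachable.trans hoy.symm
  have hnum := QuantHarris.real_pos_of_mem w E hE0 hE1 _ η hηE hmem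
  have hden : 0 < (prodBernoulli w).real {ω : BondConfig (Fin n) | ∀ a ∈ A, ¬ (openGraph ω).Reachable k a} :=
    lt_of_lt_of_le hnum (measureReal_mono Set.inter_subset_left)
  unfold avoidConst
  exact div_pos hnum hden

end CSH

end Summit.CriticalPhenomena.PercolationContinuityZ3.Theorems

end
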